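import Literature.AnabelianGeometry.SemiGraphs.TieLocalWitness

/-!
# The TIE in section-map form: `σ_w`, `σ_{e′}` factor through the canonical labels
# ([SemiAnbd] Def. 2.2 (i) p. 23, Rem. 2.2.1 p. 24)

Mochizuki, *Semi-graphs of anabelioids*, Publ. RIMS **42** (2006) 221–322, §2, Def. 2.2 (i) p. 23 and
Rem. 2.2.1 p. 24 [cite: MochizukiSemiAnbd2006, Def. 2.2(i) p.23].

PROOF-ONLY corollary (abc-iut cell, layer L3; FACT-LIST row F-1478 `remark_2_4_1_covering`, brick (T-δ)
of `HOME/staging/f/f-161/J1-TIE-ROUTE.md` in the SHAPE abc-iut-w5-d041's Route W closer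
`IsFiniteEtaleCoveringOf.comp_of_tie` binds (STATUS 2026-08-26T21:02:49Z, binder (iii)): «`O/OE` with
`w ↦ (ψ w, O w)`, `e′ ↦ (ψ e′, OE e′)` bijective AND `∃ τ, τ ≫ (O w).1.arrow = σ_w` (resp. `σ_{e′}` at the
`rfl` presentation)»; seat abc-iut-f-161):

* `sectionE_factors_of_label` — the edge twin of `TieLabels.localGlobalSection_factors`: abc-iut-w4-d079's
  edge section map `σ_{e′}` of a local witness on a CONNECTED `Q` factors through the component through
  which `g_{e′}` factors (no alignment hypothesis needed);
* `tie_sectionMaps` — for a four-clause covering of connected semi-graphs of anabelioids: labels `O`,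
  `OE`, bijective, such that for EVERY local vertex witness `(P₀, α_w, e_w)` the section map `σ_w`
  factors through `O w`, and for EVERY local edge witness `(Q, α_{e′}, e_{e′})` (and terminality datum
  `hT`) the edge section map `σ_{e′}` factors through `OE e′`.

No `def`, no new `Prop`; nothing here takes a side on [IUTchIII] Cor. 3.12.
-/

namespace Literature.AnabelianGeometry.SemiGraphs

namespace SemiGraphOfAnabelioids

namespace Hom

open CategoryTheory CategoryTheory.Limits CategoryTheory.PreGaloisCategory
open Literature.AnabelianGeometry.Anabelioids

universe v₁ u₁ u

variable {ℋ 𝒦 : SemiGraphOfAnabelioids.{v₁, u₁, u}} (ψ : Hom ℋ 𝒦) (A : 𝒦.BObj)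
  [HasBinaryProducts 𝒦.BObj] (αψ : Over A ⥤ ℋ.BObj) [αψ.IsEquivalence]
  (eψ : ψ.pullbackFunctor ≅ Over.star A ⋙ αψ)

set_option backward.isDefEq.respectTransparency false in
/-- **The edge section map lands in the edge label.**  For a local witness at the edge `e′` on a
CONNECTED `Q ∈ 𝒦_{ψ e′}` (`α_{e′} : (𝒦_{ψ e′})_{/Q} ⥲ ℋ_{e′}`, `e_{e′} : ψ_{e′}^* ≅ (Q × −) ⋙ α_{e′}`), the
edge section map `σ_{e′} : Q ⟶ A_{ψ e′}` (abc-iut-w4-d079's `OverStar.sectionMap` of the evident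
identification, at the `rfl` presentation) factors through the component `P ⊆ A_{ψ e′}` through which
`g_{e′}` factors: `F(σ_{e′})` sends the local edge base point to the global one
(`map_sectionMapE_basePoint_std`), which lies in `F(P)`. [cite: MochizukiSemiAnbd2006, Rem. 2.2.1 p.24] -/
theorem sectionE_factors_of_label (e' : ℋ.graph.Edge) (Q : 𝒦.E (ψ.base.edgeMap e'))
    [PreGaloisCategory.IsConnected Q] (αE : Over Q ⥤ ℋ.E e') [αE.IsEquivalence]
    (eEloc : (ψ.φE e' (ψ.base.edgeMap e') rfl).pullback ≅ Over.star Q ⋙ αE)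
    (hT : IsTerminal ((αψ ⋙ ℋ.ρE e' ⋙ αE.inv).obj (Over.mk (𝟙 A))))
    (P : π₀Obj (A.T (ψ.base.edgeMap e')))
    (hP : ∃ k : (αψ.obj (Over.mk (𝟙 A))).T e' ⟶
        (ψ.φE e' (ψ.base.edgeMap e') rfl).pullback.obj (P.1 : 𝒦.E (ψ.base.edgeMap e')),
      k ≫ (ψ.φE e' (ψ.base.edgeMap e') rfl).pullback.map P.1.arrow =
        (αψ.map ((Over.forgetAdjStar A).unit.app (Over.mk (𝟙 A))) ≫ eψ.inv.app A).fT e') :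
    ∃ k : Q ⟶ (P.1 : 𝒦.E (ψ.base.edgeMap e')),
      k ≫ P.1.arrow =
        OverStar.sectionMap (Over.forgetAdjStar A) (Over.forgetAdjStar Q)
          (αψ ⋙ ℋ.ρE e' ⋙ αE.inv) (𝒦.ρE (ψ.base.edgeMap e'))
          (Functor.isoWhiskerRight eψ.symm (ℋ.ρE e' ⋙ αE.inv) ≪≫
            Functor.isoWhiskerRight
              (ψ.reindexIso e' (ψ.base.edgeMap e') (ψ.base.edgeMap e') rfl rfl) αE.inv ≪≫
            Functor.isoWhiskerLeft (𝒦.ρE (ψ.base.edgeMap e')) (Functor.isoWhiskerRight eEloc αE.inv) ≪≫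
            Functor.isoWhiskerLeft (𝒦.ρE (ψ.base.edgeMap e') ⋙ Over.star Q)
              αE.asEquivalence.unitIso.symm :
              Over.star A ⋙ (αψ ⋙ ℋ.ρE e' ⋙ αE.inv) ≅ 𝒦.ρE (ψ.base.edgeMap e') ⋙ Over.star Q) hT := by
  -- basepoints `F_{e′}` of `ℋ_{e′}`, `F := ψ_{e′}^* ⋙ F_{e′}`
  let Fe' := GaloisCategory.getFiberFunctor (ℋ.E e')
  let F : 𝒦.E (ψ.base.edgeMap e') ⥤ FintypeCat.{v₁} := (ψ.φE e' (ψ.base.edgeMap e') rfl).pullback ⋙ Fe'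
  haveI : FiberFunctor F := fiberFunctor_comp_of_exact _ Fe'
  obtain ⟨eT⟩ := nonempty_equiv_fiber_terminal_punit Fe'
  obtain ⟨-, -, hρE⟩ := ℋ.hasLimitsOfShape_bObj (J := Discrete PEmpty.{1})
  haveI := hρE e'
  have hTA : IsTerminal ((ℋ.ρE e').obj (αψ.obj (Over.mk (𝟙 A)))) :=
    (Over.mkIdTerminal.isTerminalObj αψ _).isTerminalObj (ℋ.ρE e') _
  let iA : (ℋ.ρE e').obj (αψ.obj (Over.mk (𝟙 A))) ≅ ⊤_ (ℋ.E e') := hTA.uniqueUpToIso terminalIsTerminal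
  haveI hsA : Subsingleton (Fe'.obj ((αψ.obj (Over.mk (𝟙 A))).T e')) :=
    ((FintypeCat.equivEquivIso.symm (Fe'.mapIso iA)).trans eT).subsingleton
  let t : (ℋ.ρE e' ⋙ Fe').obj (αψ.obj (Over.mk (𝟙 A))) :=
    (FintypeCat.equivEquivIso.symm (Fe'.mapIso iA)).symm (eT.symm PUnit.unit)
  have hTQ : IsTerminal (αE.obj (Over.mk (𝟙 Q))) := Over.mkIdTerminal.isTerminalObj αE _
  let iQ : αE.obj (Over.mk (𝟙 Q)) ≅ ⊤_ (ℋ.E e') := hTQ.uniqueUpToIso terminalIsTerminal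
  let t' : Fe'.obj (αE.obj (Over.mk (𝟙 Q))) :=
    (FintypeCat.equivEquivIso.symm (Fe'.mapIso iQ)).symm (eT.symm PUnit.unit)
  have hbase := map_sectionMapE_basePoint_std ψ A αψ eψ e' (ψ.base.edgeMap e') rfl Q αE eEloc hT
    Fe' F (Iso.refl F) t t'
  have hPmem := (sectionE_factors_iff_mem_range ψ A αψ eψ e' Fe' t P).mp hP
  have hmem : F.map (OverStar.sectionMap (Over.forgetAdjStar A) (Over.forgetAdjStar Q)
          (αψ ⋙ ℋ.ρE e' ⋙ αE.inv) (𝒦.ρE (ψ.base.edgeMap e'))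
          (Functor.isoWhiskerRight eψ.symm (ℋ.ρE e' ⋙ αE.inv) ≪≫
            Functor.isoWhiskerRight
              (ψ.reindexIso e' (ψ.base.edgeMap e') (ψ.base.edgeMap e') rfl rfl) αE.inv ≪≫
            Functor.isoWhiskerLeft (𝒦.ρE (ψ.base.edgeMap e')) (Functor.isoWhiskerRight eEloc αE.inv) ≪≫
            Functor.isoWhiskerLeft (𝒦.ρE (ψ.base.edgeMap e') ⋙ Over.star Q)
              αE.asEquivalence.unitIso.symm :
              Over.star A ⋙ (αψ ⋙ ℋ.ρE e' ⋙ αE.inv) ≅ 𝒦.ρE (ψ.base.edgeMap e') ⋙ Over.star Q) hT)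
        ((Iso.refl F).hom.app Q (Fe'.map (αE.map ((Over.forgetAdjStar Q).unit.app (Over.mk (𝟙 Q))) ≫
          eEloc.inv.app Q) t')) ∈ Set.range (F.map P.1.arrow) := by
    rw [hbase]
    change (Fe'.map ((ψ.reindexIso e' (ψ.base.edgeMap e') (ψ.base.edgeMap e') rfl rfl).hom.app A) ≫
        𝟙 _) (Fe'.map ((αψ.map ((Over.forgetAdjStar A).unit.app (Over.mk (𝟙 A))) ≫
          eψ.inv.app A).fT e') t) ∈ Set.range (F.map P.1.arrow)
    rw [reindexIso_rfl_eq, Iso.refl_hom, NatTrans.id_app, Fe'.map_id, Category.comp_id,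
      FintypeCat.id_apply]
    exact hPmem
  exact (factor_iff_map_mem_range F P.1.arrow _ _).mpr hmem

/-- **THE TIE, section-map form** (the binder of abc-iut-w5-d041's Route W closer).  For a morphism
`ψ : ℋ → 𝒦` of connected semi-graphs of anabelioids, locally the covering attached to `A`, globally so
through `αψ`, `e_ψ`, branch-aligned and vertex-aligned: there are labels `O(w) ⊆ A_{ψ w}`, `OE(e′) ⊆ A_{ψ e′}`
such that `w ↦ (ψ w, O w)` and `e′ ↦ (ψ e′, OE e′)` are bijections, and for EVERY local vertex witness
`(P₀, α_w, e_w)` (`P₀` connected) the section map `σ_w` (abc-iut-w5-d041 `Hom.localGlobalSection`)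
factors through `O w ↪ A_{ψ w}`, and for EVERY local edge witness `(Q, α_{e′}, e_{e′})` (`Q` connected,
terminality datum `hT`) the edge section map `σ_{e′}` (abc-iut-w4-d079, `rfl` presentation) factors
through `OE e′ ↪ A_{ψ e′}`. [cite: MochizukiSemiAnbd2006, Def. 2.2(i) p.23] -/
theorem tie_sectionMaps (hloc : ψ.IsFiniteEtaleCoveringOf A) (hal : ψ.IsBranchAligned)
    (hva : ψ.IsVertexAligned) (hℋ : ℋ.IsConnected) (h𝒦 : 𝒦.IsConnected) :
    ∃ (O : ∀ w : ℋ.graph.Vertex, π₀Obj (A.S (ψ.base.vertexMap w)))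
      (OE : ∀ e' : ℋ.graph.Edge, π₀Obj (A.T (ψ.base.edgeMap e'))),
      Function.Bijective (fun w : ℋ.graph.Vertex =>
        (⟨ψ.base.vertexMap w, O w⟩ : Σ u, π₀Obj (A.S u))) ∧
      Function.Bijective (fun e' : ℋ.graph.Edge =>
        (⟨ψ.base.edgeMap e', OE e'⟩ : Σ e, π₀Obj (A.T e))) ∧
      (∀ (w : ℋ.graph.Vertex) (P₀ : 𝒦.V (ψ.base.vertexMap w)) [PreGaloisCategory.IsConnected P₀]
          (αw : Over P₀ ⥤ ℋ.V w) [αw.IsEquivalence] (ew : (ψ.φV w).pullback ≅ Over.star P₀ ⋙ αw),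
        ∃ τ : P₀ ⟶ ((O w).1 : 𝒦.V (ψ.base.vertexMap w)),
          τ ≫ (O w).1.arrow = Hom.localGlobalSection ψ A αψ w P₀ αw eψ ew) ∧
      (∀ (e' : ℋ.graph.Edge) (Q : 𝒦.E (ψ.base.edgeMap e')) [PreGaloisCategory.IsConnected Q]
          (αE : Over Q ⥤ ℋ.E e') [αE.IsEquivalence]
          (eEloc : (ψ.φE e' (ψ.base.edgeMap e') rfl).pullback ≅ Over.star Q ⋙ αE)
          (hT : IsTerminal ((αψ ⋙ ℋ.ρE e' ⋙ αE.inv).obj (Over.mk (𝟙 A)))),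
        ∃ τ : Q ⟶ ((OE e').1 : 𝒦.E (ψ.base.edgeMap e')),
          τ ≫ (OE e').1.arrow =
            OverStar.sectionMap (Over.forgetAdjStar A) (Over.forgetAdjStar Q)
              (αψ ⋙ ℋ.ρE e' ⋙ αE.inv) (𝒦.ρE (ψ.base.edgeMap e'))
              (Functor.isoWhiskerRight eψ.symm (ℋ.ρE e' ⋙ αE.inv) ≪≫
                Functor.isoWhiskerRight
                  (ψ.reindexIso e' (ψ.base.edgeMap e') (ψ.base.edgeMap e') rfl rfl) αE.inv ≪≫
                Functor.isoWhiskerLeft (𝒦.ρE (ψ.base.edgeMap e'))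
                  (Functor.isoWhiskerRight eEloc αE.inv) ≪≫
                Functor.isoWhiskerLeft (𝒦.ρE (ψ.base.edgeMap e') ⋙ Over.star Q)
                  αE.asEquivalence.unitIso.symm :
                  Over.star A ⋙ (αψ ⋙ ℋ.ρE e' ⋙ αE.inv) ≅ 𝒦.ρE (ψ.base.edgeMap e') ⋙ Over.star Q)
              hT) := by
  obtain ⟨O, OE, h1, h2, h3, h4, -⟩ := tie_bijective ψ A αψ eψ hloc hal hva hℋ h𝒦
  refine ⟨O, OE, h1, h2, fun w P₀ _ αw _ ew => ?_, fun e' Q _ αE _ eEloc hT => ?_⟩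
  · exact localGlobalSection_factors ψ A αψ eψ w P₀ αw ew (O w) ((h3 w (O w)).mp rfl)
  · exact sectionE_factors_of_label ψ A αψ eψ e' Q αE eEloc hT (OE e') ((h4 e' (OE e')).mp rfl)

end Hom

end SemiGraphOfAnabelioids

end Literature.AnabelianGeometry.SemiGraphs
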